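import Summits.ABC.IUTFork.LDHSyntheticCor312Failure
import HarnessLib

/-!
# The fork at [IUTchIII] Corollary 3.12, L-DH level: the CLAIM-form `Cor312Of` is CONTENTFUL at the input type — it HOLDS for a shallow
# synthetic input and FAILS for a deep one

Record-only file (D-0012) of the abc-iut cell (WAVE-5 prover abc-iut-w5-d157); TAKES NO SIDE on Cor. 3.12. Companion of
`LDHSyntheticCor312Failure` (`exists_deepAt_not_cor312Of`: abc-iut-S2's claim form
`ThetaVolumeInput.Cor312Of` FAILS for the synthetic input `deepAt p l N σ` of large depth). Here the other half:
* `DHData.lnνLp_region_tΘ_le_negLogThetaLoc` — for EVERY genuine input and prime, `−c_l·Q_p = ln ν̄_{𝕃_p}(O_𝕃(−P_Θ)) ≤ −|log(Θ)|_p`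
  (the hull contains the bare region; monotonicity of `ln ν̄` — the lower bound S8's `LDHSlotResidue` uses globally);
* `ThetaVolumeInput.cor312Of_deepAt_of_shallow` — for the synthetic input over a degree-one base: `(c_l − 1)·N·log p ≤ ((l+5)/4)·log π`
  implies `Cor312Of` (the Θ-side is `≥ −c_l·N·log p + ((l+5)/4)·log π`, every other support prime contributing `≥ 0`, the `q`-side is
  `−N·log p`: at small depth the ARCHIMEDEAN summand of [IUTchIV] Thm. 1.10 Step (vii) pays for the local deficit);
* `ThetaVolumeInput.cor312Of_deepAt_three_five_one` — the instance `p = 3`, `l = 5`, `N = 1` (`c_l = 5/2`, `(3/2)·log 3 ≤ (5/2)·log π`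
  from `3 < π`), over `[F₀:ℚ] = 1`, any `K ⊇ F₀` and section;
* `ThetaVolumeInput.cor312Of_independent` — hence `(∃ input, Cor312Of) ∧ (∃ input, ¬ Cor312Of)` at every `(F₀, K, σ)` with
  `[F₀:ℚ] = 1` (the general-base twin follows the same way from `LDHPerPrimeReadingSlotConstant`): the claim form is
  neither a tautology nor a contradiction of the genuine-completion volume formalism — the L-DH / genuine analogue of abc-iut-S2's
  witness-level `LDHWitnessEstimate.cor312DH_independent` and of TEAM A's interface-level satisfiability / countermodel pair.
HONEST SCOPE: synthetic inhabitants of the input TYPE (pilot data `j_E = p^{−2lN}`), not the Θ-volume inputs of initial Θ-data; nothing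
here bears on whether [IUTchIII] Thm. 3.11 licenses (1.1). [cite: DupuyHilado2025, §1 (1.1), Thm. 3.10.1, §4.10–4.12]
[cite: Mochizuki2012, IUTchIV Thm. 1.10 Step (vii) p. 30] [claim: Mochizuki2012, status: disputed] for every IUT quotation.
-/

noncomputable section

open Set NumberField IsDedekindDomain Literature.IUT.LogVolume

namespace Summit.ABC.IUTFork

variable {F₀ : Type} [Field F₀] [NumberField F₀] {K : Type} [Field K] [NumberField K] [Algebra F₀ K]

namespace DHData

/-- **The bare Θ-region bounds the hull from below at every prime**: `ln ν̄_{𝕃_p}(O_𝕃(−P_Θ)_p) ≤ ln ν̄_{𝕃_p}(hull(U_Θ)_p)` for ANY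
Dupuy–Hilado data (the hull contains the identity image, which contains the bare region; `ln ν̄` is monotone on admissible regions).
[cite: DupuyHilado2025, §4.10–4.12, Def. 3.6.3] -/
theorem lnνLp_region_tΘ_le_hullUTheta (D : DHData F₀) (p : ℕ) :
    D.M.lnνLp D.X.lstar p (D.M.region D.tΘ) ≤ D.M.lnνLp D.X.lstar p (D.M.hullUTheta D.ind3) :=
  D.M.lnνLp_mono D.X.lstar p (D.M.region_adm D.tΘ) D.hull_adm fun p j e =>
    (D.M.region_subset_UTheta_one D.ind3 p j e).trans (D.M.UTheta_le_hullUTheta D.ind3 _ p j e)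

/-- **`−c_l·Q_p ≤ −|log(Θ)|_p` for every genuine input and every prime.** [cite: DupuyHilado2025, Thm. 3.10.1, §4.10–4.12] -/
theorem lnνLp_region_tΘ_le_negLogThetaLoc (I : ThetaVolumeInput F₀ K) {p : ℕ} (hp : p.Prime) :
    -((((I.X.lstar : ℝ) + 1) * (2 * I.X.lstar + 1) / 6) *
        FinDivisor.ndeg F₀ (∑ v : placesOver F₀ p, FinDivisor.of v.1 (I.X.qPilot v.1))) ≤ I.negLogThetaLoc p := by
  haveI : Fact p.Prime := ⟨hp⟩
  have h2 : (ofInput I).M.lnνLp I.X.lstar p ((ofInput I).M.region (ofInput I).tΘ) =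
      -((((I.X.lstar : ℝ) + 1) * (2 * I.X.lstar + 1) / 6) *
          FinDivisor.ndeg F₀ (∑ v : placesOver F₀ p, FinDivisor.of v.1 (I.X.qPilot v.1))) :=
    (ofInput I).lnνLp_region_tΘ_eq p
  rw [← lnνLp_hullUTheta_ofInput I hp, ← h2]
  exact lnνLp_region_tΘ_le_hullUTheta (ofInput I) p

/-- Hence `0 ≤ −|log(Θ)|_p` at a prime carrying no `q`-mass (`Q_p = 0`). [cite: DupuyHilado2025, §4.10–4.12] -/
theorem negLogThetaLoc_nonneg_of_localQMass_eq_zero (I : ThetaVolumeInput F₀ K) {p : ℕ} (hp : p.Prime)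
    (hQ : FinDivisor.ndeg F₀ (∑ v : placesOver F₀ p, FinDivisor.of v.1 (I.X.qPilot v.1)) = 0) : 0 ≤ I.negLogThetaLoc p := by
  have h := lnνLp_region_tΘ_le_negLogThetaLoc I hp
  rw [hQ, mul_zero, neg_zero] at h
  exact h

end DHData

namespace ThetaVolumeInput

variable (p : ℕ) [hp : Fact p.Prime] (l : ℕ) (hl : l.Prime) (h5 : 5 ≤ l) (N : ℕ) (hN : 0 < N) (σ : PlaceSection F₀ K)

/-- At a prime `p' ≠ p` the synthetic input carries no `q`-mass: `Q_{p'} = 0`. [cite: DupuyHilado2025, §3.3] -/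
theorem deepAt_localQMass_eq_zero {p' : ℕ} [hp' : Fact p'.Prime] (hpp : p' ≠ p) :
    FinDivisor.ndeg F₀ (∑ v : placesOver F₀ p', FinDivisor.of v.1 ((deepAt p l hl h5 N hN σ).X.qPilot v.1)) = 0 := by
  classical
  have hv : ∀ v : placesOver F₀ p', (deepAt p l hl h5 N hN σ).X.qPilot v.1 = 0 := by
    intro v
    rw [PilotData.qPilot_apply']
    have hS : v.1 ∉ (deepAt p l hl h5 N hN σ).X.S := by
      intro hmem
      have h1 := (mem_placesOver_iff_residueChar v.1).mp v.2
      have h2 := (mem_placesOver_iff_residueChar v.1).mp (show v.1 ∈ placesOver F₀ p from hmem)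
      exact hpp (h1.symm.trans h2)
    rw [if_neg hS]
  simp_rw [hv]
  simp

/-- **`Cor312Of` HOLDS for the synthetic input at SHALLOW depth** (degree-one base; `v₀` the place over `p`): if
`(c_l − 1)·N·e_{v₀}·ln N(v₀) ≤ ((l+5)/4)·log π` then `−|log(q)| ≤ −|log(Θ)|` for `deepAt p l N σ` — the archimedean summand of Step
(vii) pays for the local deficit at `p`, and every other support prime contributes `≥ 0`. [cite: Mochizuki2012, IUTchIV Thm. 1.10 Step (vii) p. 30]
[cite: DupuyHilado2025, §1 (1.1), Thm. 3.10.1] [claim: Mochizuki2012, status: disputed] -/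
theorem cor312Of_deepAt_of_shallow (hF : Module.finrank ℚ F₀ = 1) (v₀ : placesOver F₀ p)
    (hsmall : (((((l - 1) / 2 : ℕ) : ℝ) + 1) * (2 * (((l - 1) / 2 : ℕ) : ℝ) + 1) / 6 - 1) *
        ((N : ℝ) * ramIdx F₀ v₀.1 * logNorm F₀ v₀.1) ≤ ThetaVolumeInput.archLogTheta l) :
    (deepAt p l hl h5 N hN σ).Cor312Of := by
  set I := deepAt p l hl h5 N hN σ with hI
  have hpT : p ∈ I.supportPrimes := by
    have := I.residueChar_mem_supportPrimes (v := v₀.1) v₀.2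
    rwa [(mem_placesOver_iff_residueChar v₀.1).mp v₀.2] at this
  have hLI : ((I.X.lstar : ℕ) : ℝ) = (((l - 1) / 2 : ℕ) : ℝ) := by rw [show I.X.lstar = (l - 1) / 2 from rfl]
  -- at `p`: the bare region bounds the hull from below
  have hθp : -(((((l - 1) / 2 : ℕ) : ℝ) + 1) * (2 * (((l - 1) / 2 : ℕ) : ℝ) + 1) / 6 *
      ((N : ℝ) * ramIdx F₀ v₀.1 * logNorm F₀ v₀.1)) ≤ I.negLogThetaLoc p := by
    have h := DHData.lnνLp_region_tΘ_le_negLogThetaLoc I hp.out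
    rw [deepAt_localQMass p l hl h5 hF N hN σ v₀, hLI] at h
    exact h
  -- elsewhere: nonnegative summands
  have hothers : ∀ p' ∈ I.supportPrimes.erase p, 0 ≤ I.negLogThetaLoc p' := fun p' hp' => by
    haveI : Fact p'.Prime := ⟨I.prime_of_mem_supportPrimes (Finset.mem_of_mem_erase hp')⟩
    exact DHData.negLogThetaLoc_nonneg_of_localQMass_eq_zero I (I.prime_of_mem_supportPrimes (Finset.mem_of_mem_erase hp'))
      (deepAt_localQMass_eq_zero p l hl h5 N hN σ (Finset.ne_of_mem_erase hp'))
  have hsum : -(((((l - 1) / 2 : ℕ) : ℝ) + 1) * (2 * (((l - 1) / 2 : ℕ) : ℝ) + 1) / 6 *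
      ((N : ℝ) * ramIdx F₀ v₀.1 * logNorm F₀ v₀.1)) ≤ I.negLogThetaNonarch := by
    rw [ThetaVolumeInput.negLogThetaNonarch, ← Finset.add_sum_erase _ _ hpT]
    have := Finset.sum_nonneg hothers
    linarith
  show I.negAbsLogQ ≤ I.negLogThetaNonarch + ThetaVolumeInput.archLogTheta I.l
  rw [deepAt_negAbsLogQ p l hl h5 hF N hN σ v₀, show I.l = l from rfl]
  linarith

/-- Over a degree-one base the one place `v₀` over `p` has `e_{v₀}·ln N(v₀) = log p` (`e_{v₀} f_{v₀} = [F₀:ℚ] = 1`).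
[cite: DupuyHilado2025, §2.5.4, §3.6] -/
theorem ramIdx_mul_logNorm_of_finrank_eq_one (hF : Module.finrank ℚ F₀ = 1) (v₀ : placesOver F₀ p) :
    (ramIdx F₀ v₀.1 : ℝ) * logNorm F₀ v₀.1 = Real.log p := by
  have hp1 := ValLine.placesOver_subsingleton_of_finrank_eq_one hF p
  have hw := DHData.weight_eq_one_of_subsingleton hp1 v₀
  rw [weight, hF, Nat.cast_one, div_one] at hw
  have hloc : localDegree F₀ v₀.1 = 1 := by exact_mod_cast hw
  have he : ramIdx F₀ v₀.1 = 1 := Nat.eq_one_of_mul_eq_one_right (hloc ▸ rfl : ramIdx F₀ v₀.1 * resDeg F₀ v₀.1 = 1)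
  have hf : resDeg F₀ v₀.1 = 1 := Nat.eq_one_of_mul_eq_one_left (hloc ▸ rfl : ramIdx F₀ v₀.1 * resDeg F₀ v₀.1 = 1)
  rw [logNorm_eq, (mem_placesOver_iff_residueChar v₀.1).mp v₀.2, he, hf]
  simp

/-- **The instance `p = 3`, `l = 5`, `N = 1`** over a degree-one base: `Cor312Of` holds for `deepAt 3 5 1 σ` (`c_5 − 1 = 3/2`,
`(3/2)·log 3 ≤ (5/2)·log π` since `3 < π`). [cite: Mochizuki2012, IUTchIV Thm. 1.10 Step (vii) p. 30] [claim: Mochizuki2012, status: disputed] -/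
theorem cor312Of_deepAt_three_five_one (hF : Module.finrank ℚ F₀ = 1) (σ : PlaceSection F₀ K) :
    (@deepAt F₀ _ _ K _ _ _ 3 ⟨Nat.prime_three⟩ 5 Nat.prime_five le_rfl 1 Nat.one_pos σ).Cor312Of := by
  haveI : Fact (Nat.Prime 3) := ⟨Nat.prime_three⟩
  obtain ⟨w, hw⟩ := placesOver_nonempty F₀ 3
  refine @cor312Of_deepAt_of_shallow F₀ _ _ K _ _ _ 3 ⟨Nat.prime_three⟩ 5 Nat.prime_five le_rfl 1 Nat.one_pos σ hF ⟨w, hw⟩ ?_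
  have hel : ((1 : ℕ) : ℝ) * ramIdx F₀ (⟨w, hw⟩ : placesOver F₀ 3).1 * logNorm F₀ (⟨w, hw⟩ : placesOver F₀ 3).1 = Real.log (3 : ℕ) := by
    rw [Nat.cast_one, one_mul, ramIdx_mul_logNorm_of_finrank_eq_one 3 hF ⟨w, hw⟩]
  rw [hel]
  have h3 : Real.log (3 : ℝ) ≤ Real.log Real.pi := Real.log_le_log (by norm_num) Real.pi_gt_three.le
  have hlog3 : 0 ≤ Real.log (3 : ℝ) := Real.log_nonneg (by norm_num)
  rw [ThetaVolumeInput.archLogTheta]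
  norm_num
  nlinarith

/-- **THE CLAIM FORM IS CONTENTFUL AT THE INPUT TYPE** (degree-one base): over `F₀` with `[F₀:ℚ] = 1`, any `K ⊇ F₀` and section `σ`
there are synthetic Θ-volume inputs for which `Cor312Of` HOLDS and others for which it FAILS — neither a tautology nor a contradiction
of the genuine-completion volume formalism. [cite: DupuyHilado2025, §1 (1.1)] [claim: Mochizuki2012, status: disputed] -/
theorem cor312Of_independent (hF : Module.finrank ℚ F₀ = 1) (σ : PlaceSection F₀ K) :
    (∃ I : ThetaVolumeInput F₀ K, I.Cor312Of) ∧ (∃ I : ThetaVolumeInput F₀ K, ¬ I.Cor312Of) := by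
  refine ⟨⟨_, cor312Of_deepAt_three_five_one hF σ⟩, ?_⟩
  obtain ⟨N, hN, h⟩ := @exists_deepAt_not_cor312Of F₀ _ _ K _ _ _ 3 ⟨Nat.prime_three⟩ 5 Nat.prime_five le_rfl hF σ
  exact ⟨_, h⟩

end ThetaVolumeInput

end Summit.ABC.IUTFork

end
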